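import Summits.QuantumFields.BalabanUV.Beta.CoclosedCovectorCompositeRows
import Summits.QuantumFields.BalabanUV.Beta.NVertexLamSectorPeriodisedStoreys
import Summits.QuantumFields.BalabanUV.Beta.FP.PeriodisedLamFoldPureGauge
import Summits.QuantumFields.BalabanUV.Beta.FP.PeriodisedWardOrderZero

/-!
# `BalabanUV.Beta.FP.TowerK1RowTopCoefficients` — road «FP», binder row D1, ROUTE T (β1): **THE ROAD's TOP COEFFICIENT TABLE FOR THE END WRAPPER's (K1) ROW —
# TWO-SCALE COVARIANCE, SLOT ↔ SITE PERIODISATION, `hcf`, AND (β): THE EXACT PART OF THE DIRECTION IS DEAD ON BOTH SIDES OF K1**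
# (`cfTop κ₁ s κ′ x := Σ_ν Σ'_w lamCoeffOf (KInv L) L ν w κ′ x·compLinKer (· ↦ symLinKerAt (toSite R.r) Lc) Lc (n+1) (κ₁,s) (ν,w)`, `L = Lc^(n+2)` — an2 g63 J-NOTE-1 (b), written out)

WHY (`HOME/b2b-balaban-beta-d1-p3/g40/SPEC-51.md` §D∕§F∕§G; an2 g63 J-NOTE-1 l.67433, W-3 l.67480; road g41 ONLINE l.67484 ∕ A-1 l.67486).  The v4 END wrapper
`FP/StepRecursionFeedNestedNamedC.d1Tel_JcComp_ctr_namedC` (p538144) DISPLAYS the finest-level coefficient table `cf (n+1)` (read only through its SLOT periodisation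
`ĉf(κ₁,s₁)(ā) = Σ'_m cf (n+1) κ₁ (translate (Ma (n+1)) s₁ m) ā.2 ā.1`), its summability row `hcf`, and the row `K1` along the direction `hb (n+1) v = hv v` — the nested
composite column, whose basis values are the torus column of the composite one-shot chart PLUS a torus pure gauge `tgrad·λ` (R-FP-79 ∕ (J-W″), g39 #5).  The road's
`cf (n+1)` is an2's J-NOTE-1 (b): the straight-chart multiplier coefficients `lamCoeffOf (KInv L) L` transported in their slot index by the (0.4)-sym composite leg
`compLinKer`.  THIS FILE supplies what the K1 assembly (`FP/TowerK1RowTopColumn`, behind an2 PART 24) needs about that table and about the gauge part: (F1) its slot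
periodisation is `T`-periodic in the site and equals the leg × leaf-03 O-2's SITE-periodised straight fold, so O-2 kills the gauge part on the right; the periodised
field block kills it on the left.

WHAT ([folklore] `tsum` ∕ finite-sum bookkeeping BY NAME; no `def`, no `def … : Prop`, nothing cited, 0 sorry; `T = towerTorus Lc (fine Lc M) (n+1)`, `T′ = towerTorus Lc M (n+1)`):
* §1 `cfTop_translate` (POINTWISE two-scale covariance: a slot shift by `T′•m` is a site shift by `−T•m` — lit `lamCoeffOf_translate` at `shiftK_KInv`, an2 PART 17
  `compLinKer_translate_of_sh`; = an2 W-3's step (3), offered to PART 25), **`tsum_cfTop_translate_eq`** ((F1): `Σ'_m cfTop κ₁ (translate T′ s₁ m) κ′ x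
  = Σ_ν Σ'_w (Σ'_m lamCoeffOf (KInv L) L ν w κ′ (translate T x m))·compLinKer … (κ₁,s₁) (ν,w)` — the exchange runs over an2 PART 20's FINITE top slice
  `summable_mul_compLinKer` and O-2's `summable_lamCoeffOf_translate`), `summable_cfTop_translate` (the wrapper's `hcf` row at level `n+1`).
* §2 (β): `ff_mul_exact_sum_eq_zero` (LEFT: `Σ_b (perF T (bhKStepAt 3 (toSite rH) Lc 0))|ff(u,b)·(tgrad·λ) b = 0` for EVERY gauge function `λ` — road
  `PeriodisedWardOrderZero.sum_perZ_bhKStepAt_ff_mul_tgrad`; #21's `torus_a0_tower` is the special case `λ := towerEvalC·θ`), **`sum_exact_mul_tsum_cfTop_eq_zero`**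
  (RIGHT: `Σ_ā (tgrad·λ) ā·ĉfTop(κ₁,s₁)(ā) = 0` — (F1), then O-2 `sum_tgrad_mul_periodisedLamFold_eq_zero` at each transport slot `(ν,w)`, `A := KInv L`, box `T`).
* §3 bookkeeping for the assembly: `sum_mul_sum_tsum_mul_symLinKerAt_comm` (the finite `Σ_ā` moves inside `Σ_{κ₁} Σ'_{s₁}`: the brick row `symLinKerAt (toSite R.r) Lc κ₁ · (u.2,u.1)`
  is finitely supported — `symLinKerAt_eq_zero`, an2 g60 `summable_of_near`), `apply_eq_sum_mul_single_of_linear` (a linear functional of the source vector is read off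
  the basis slots `Pi.single a 1`).
WHAT THIS IS NOT: not K1 (that is `FP/TowerK1RowTopColumn.K1_row_top`, behind PART 24), not (J-Λ-fold) (an2 PART 25 `Beta/NVertexLamFold`), not `hlink` ∕ the lower levels;
no row of the END wrapper discharged here (`hcf` at level `n+1` is inhabited by §1 for the road's table — a summability letter, not content); 0 estimates; nothing of
Bałaban's asserted, valued or discharged; 0∕4 row-D1 binders (hW, hR, D1Tel, D1Rep); ROOT M‴ p325680 ∕ P5c ∕ D6 untouched; NOT (C1), NOT (L2′), NOT (T-ID), NOT SDF,
NOT D1, NEVER «G-an2-4 closed», NOT BetaPertH, NOT continuum, NOT Clay.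

HONEST DEPENDENCY (page 1, mandatory): continuum YM on T⁴ ⇐ BetaPertH ∧ nine spine estimates (0/9 proved); BetaPertH ⇐ (D1) ∧ (D4) ∧ CAP+tail;
G-an2-4 gates asym, D1 and NE2/3/4.  HONEST FRAMING (cell contract, verbatim): «discharging `BetaPertH` makes Bałaban's UV stability UNCONDITIONAL —
a real constructive-QFT result; it is NOT the continuum limit and NOT the Clay problem.»  ABSOLUTE RULE (cell charter, verbatim): «No internally-minted
statement may enter as a cited fact. Every hypothesis is either kernel-proved in this package or a verbatim quotation of a PUBLISHED theorem with page
reference. The manuscript(s) under audit are NOT citable for their own disputed steps — they are the thing under adjudication; programme-internal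
(2001/route/tribunal) claims are never citable.»  Road «FP» OWNER, b2b-balaban-beta-d1-p3 gen 41, 2026-08-27.  No existing file touched.
-/

noncomputable section

open scoped BigOperators

namespace Summit.QuantumFields.BalabanUV.Beta.FP.TowerK1RowTopCoefficients

open Finset
open Literature.MathematicalPhysics.QuantumFieldTheory
open Literature.MathematicalPhysics.QuantumFieldTheory.Balaban1983to89
open Literature.MathematicalPhysics.QuantumFieldTheory.Balaban1983to89.Beta
open B4TorusKernel.MultiPeriod (translate translate_apply)
open B5Prop11Plancherel (fine)
open B6Lemma24Torus (pbox)
open AffineAveraging (Site box toSite)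
open AveragingHessianKernels (Bond)
open ExpKernelCalculus (MKer Decays shiftK)
open OneStepResolventKernel (Fib KInv decays_KInv shiftK_KInv)
open BalabanStepJets (lamCoeffOf lamCoeffOf_translate)
open Summit.QuantumFields.BalabanUV.Beta.CompositeOneShotJetData (Roots)
open Summit.QuantumFields.BalabanUV.Beta.SymAveragingHessianCounts (symLinKerAt symLinKerAt_eq_zero symLinKerAt_add)
open Summit.QuantumFields.BalabanUV.Beta.CompositeVertexKernelRec (compLinKer compLinKer_eq_zero wid winF)
open Summit.QuantumFields.BalabanUV.Beta.CompositeVertexKernelLiftKernel (mem_piFinset_of_mem_winF)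
open Summit.QuantumFields.BalabanUV.Beta.BorderedHessian (bhKStepAt)
open Summit.QuantumFields.BalabanUV.Beta.FP.KernelPeriodisationFib (Idx perF perZ perF_apply translate_eq_add)
open Summit.QuantumFields.BalabanUV.Beta.FP.TorusCompositeObjects (towerTorus towerTorus_apply)
open Summit.QuantumFields.BalabanUV.Beta.FP.TorusGaugeCovariance (tgrad)
open Summit.QuantumFields.BalabanUV.Beta.FP.PeriodisedLamFoldPureGauge (summable_lamCoeffOf_translate sum_tgrad_mul_periodisedLamFold_eq_zero)
open Summit.QuantumFields.BalabanUV.Beta.FP.PeriodisedWardOrderZero (sum_perZ_bhKStepAt_ff_mul_tgrad)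
open Summit.QuantumFields.BalabanUV.Beta.NVertexLamSectorPeriodisedStoreys (compLinKer_translate_of_sh)
open Summit.QuantumFields.BalabanUV.Beta.CoclosedCovectorCompositeRows (summable_mul_compLinKer)
open Summit.QuantumFields.BalabanUV.Beta.CoclosedCovectorLinearRowsNear (summable_of_near)

variable {Lc : ℕ} [NeZero Lc] (R : Roots Lc) (n : ℕ) (M : Fin (3 + 1) → ℕ) [∀ i, NeZero (M i)]

/-! ## §1 The transported straight-chart coefficients: two-scale covariance, slot ↔ site periodisation, `hcf` at the top -/

section Coefficients

omit [∀ i, NeZero (M i)] in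
/-- [folklore] **`cfTop_translate` — POINTWISE TWO-SCALE COVARIANCE OF THE TRANSPORTED COEFFICIENTS** (an2 W-3's step (3)): shifting the lower slot by a period
`(towerTorus Lc M (n+1))•m` of the slot torus equals shifting the fine site by MINUS the period `(towerTorus Lc (fine Lc M) (n+1))•m` of the bond torus —
re-index the top slot `w ↦ translate M w m` (an2 PART 17 `compLinKer_translate_of_sh` at `Tc := M`) and move the block shift onto the site
(lit `lamCoeffOf_translate` at `OneStepResolventKernel.shiftK_KInv`, `T = L·M`). -/
theorem cfTop_translate (κ₁ : Fin (3 + 1)) (s₁ : Site (3 + 1)) (κ' : Fin (3 + 1)) (x m : Site (3 + 1)) :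
    (∑ ν : Fin (3 + 1), ∑' w : Site (3 + 1),
        lamCoeffOf (KInv (N := Lc ^ (n + 1 + 1)) (d := 3)) (Lc ^ (n + 1 + 1)) ν w κ' x
          * compLinKer (fun _ => symLinKerAt (toSite R.r) Lc) Lc (n + 1) (κ₁, translate (towerTorus Lc M (n + 1)) s₁ m) (ν, w))
      = ∑ ν : Fin (3 + 1), ∑' w : Site (3 + 1),
          lamCoeffOf (KInv (N := Lc ^ (n + 1 + 1)) (d := 3)) (Lc ^ (n + 1 + 1)) ν w κ'
              (translate (towerTorus Lc (fine Lc M) (n + 1)) x (-m))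
            * compLinKer (fun _ => symLinKerAt (toSite R.r) Lc) Lc (n + 1) (κ₁, s₁) (ν, w) := by
  refine Finset.sum_congr rfl fun ν _ => ?_
  set t : Site (3 + 1) := fun i => (M i : ℤ) * m i with ht
  have htr : ∀ w : Site (3 + 1), translate M w m = w + t := fun w => translate_eq_add M w m
  have hx : x = translate (towerTorus Lc (fine Lc M) (n + 1)) x (-m) + ((Lc ^ (n + 1 + 1) : ℕ) : ℤ) • t := by
    funext i
    simp only [translate_apply, Pi.add_apply, Pi.smul_apply, smul_eq_mul, ht, towerTorus_apply, fine, Pi.neg_apply, Nat.cast_mul,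
      Nat.cast_pow]
    ring
  rw [← (Equiv.addRight t).tsum_eq (fun w : Site (3 + 1) =>
    lamCoeffOf (KInv (N := Lc ^ (n + 1 + 1)) (d := 3)) (Lc ^ (n + 1 + 1)) ν w κ' x
      * compLinKer (fun _ => symLinKerAt (toSite R.r) Lc) Lc (n + 1) (κ₁, translate (towerTorus Lc M (n + 1)) s₁ m) (ν, w))]
  refine tsum_congr fun w => ?_
  have h1 : compLinKer (fun _ => symLinKerAt (toSite R.r) Lc) Lc (n + 1) (κ₁, translate (towerTorus Lc M (n + 1)) s₁ m) (ν, w + t)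
      = compLinKer (fun _ => symLinKerAt (toSite R.r) Lc) Lc (n + 1) (κ₁, s₁) (ν, w) := by
    rw [← htr w]
    exact compLinKer_translate_of_sh (fun _ μ' y' t' f => symLinKerAt_add (toSite R.r) Lc μ' y' t' f) M (n + 1) m w ν s₁ κ₁
  have h2 : lamCoeffOf (KInv (N := Lc ^ (n + 1 + 1)) (d := 3)) (Lc ^ (n + 1 + 1)) ν (w + t) κ' x
      = lamCoeffOf (KInv (N := Lc ^ (n + 1 + 1)) (d := 3)) (Lc ^ (n + 1 + 1)) ν w κ'
          (translate (towerTorus Lc (fine Lc M) (n + 1)) x (-m)) := by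
    conv_lhs => rw [hx]
    exact lamCoeffOf_translate (fun t' => shiftK_KInv (N := Lc ^ (n + 1 + 1)) (d := 3) t') ν w κ' _ t
  simp only [Equiv.coe_addRight]
  rw [h1, h2]

/-- [folklore] **`tsum_cfTop_translate_eq` — (F1) THE SLOT-PERIODISED TRANSPORTED COEFFICIENT IS THE LEG × THE SITE-PERIODISED STRAIGHT FOLD**:
`Σ'_m cfTop κ₁ (translate T′ s₁ m) κ′ x = Σ_ν Σ'_w (Σ'_m lamCoeffOf (KInv L) L ν w κ′ (translate T x m))·compLinKer … (κ₁,s₁) (ν,w)` — §1's covariance, `m ↦ −m`, and the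
exchange of `Σ'_m` with the FINITE top slice `{w : compLinKer … (κ₁,s₁) (ν,w) ≠ 0}` (an2 PART 20's window letter; lit∕O-2 `summable_lamCoeffOf_translate`). -/
theorem tsum_cfTop_translate_eq (κ₁ : Fin (3 + 1)) (s₁ : Site (3 + 1)) (κ' : Fin (3 + 1)) (x : Site (3 + 1)) :
    (∑' m : Site (3 + 1), ∑ ν : Fin (3 + 1), ∑' w : Site (3 + 1),
        lamCoeffOf (KInv (N := Lc ^ (n + 1 + 1)) (d := 3)) (Lc ^ (n + 1 + 1)) ν w κ' x
          * compLinKer (fun _ => symLinKerAt (toSite R.r) Lc) Lc (n + 1) (κ₁, translate (towerTorus Lc M (n + 1)) s₁ m) (ν, w))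
      = ∑ ν : Fin (3 + 1), ∑' w : Site (3 + 1),
          (∑' m : Site (3 + 1), lamCoeffOf (KInv (N := Lc ^ (n + 1 + 1)) (d := 3)) (Lc ^ (n + 1 + 1)) ν w κ'
              (translate (towerTorus Lc (fine Lc M) (n + 1)) x m))
            * compLinKer (fun _ => symLinKerAt (toSite R.r) Lc) Lc (n + 1) (κ₁, s₁) (ν, w) := by
  have hL : 0 < Lc := Nat.pos_of_ne_zero (NeZero.ne Lc)
  -- step 1: pointwise covariance and `m ↦ −m`
  have h1 : (∑' m : Site (3 + 1), ∑ ν : Fin (3 + 1), ∑' w : Site (3 + 1),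
        lamCoeffOf (KInv (N := Lc ^ (n + 1 + 1)) (d := 3)) (Lc ^ (n + 1 + 1)) ν w κ' x
          * compLinKer (fun _ => symLinKerAt (toSite R.r) Lc) Lc (n + 1) (κ₁, translate (towerTorus Lc M (n + 1)) s₁ m) (ν, w))
      = ∑' m : Site (3 + 1), ∑ ν : Fin (3 + 1), ∑' w : Site (3 + 1),
          lamCoeffOf (KInv (N := Lc ^ (n + 1 + 1)) (d := 3)) (Lc ^ (n + 1 + 1)) ν w κ'
              (translate (towerTorus Lc (fine Lc M) (n + 1)) x m)
            * compLinKer (fun _ => symLinKerAt (toSite R.r) Lc) Lc (n + 1) (κ₁, s₁) (ν, w) := by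
    rw [← (Equiv.neg (Site (3 + 1))).tsum_eq (fun m : Site (3 + 1) => ∑ ν : Fin (3 + 1), ∑' w : Site (3 + 1),
          lamCoeffOf (KInv (N := Lc ^ (n + 1 + 1)) (d := 3)) (Lc ^ (n + 1 + 1)) ν w κ'
              (translate (towerTorus Lc (fine Lc M) (n + 1)) x m)
            * compLinKer (fun _ => symLinKerAt (toSite R.r) Lc) Lc (n + 1) (κ₁, s₁) (ν, w))]
    refine tsum_congr fun m => ?_
    rw [Equiv.neg_apply, cfTop_translate R n M κ₁ s₁ κ' x m]
  rw [h1]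
  -- step 2: the top slice is finite, uniformly in `m`
  set S : Finset (Site (3 + 1)) := Fintype.piFinset fun i =>
    Finset.Icc ((s₁ i - (wid Lc (n + 1) : ℤ)) / ((Lc ^ (n + 1) : ℕ) : ℤ)) (s₁ i / ((Lc ^ (n + 1) : ℕ) : ℤ)) with hS
  have hzero : ∀ (ν : Fin (3 + 1)) (w : Site (3 + 1)), w ∉ S →
      compLinKer (fun _ => symLinKerAt (toSite R.r) Lc) Lc (n + 1) (κ₁, s₁) (ν, w) = 0 := fun ν w hw =>
    compLinKer_eq_zero (n + 1) (f := (κ₁, s₁)) (g := (ν, w)) fun h => hw (mem_piFinset_of_mem_winF (pow_pos hL (n + 1)) h)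
  have hfin : ∀ (c : Site (3 + 1) → ℝ) (ν : Fin (3 + 1)),
      (∑' w : Site (3 + 1), c w * compLinKer (fun _ => symLinKerAt (toSite R.r) Lc) Lc (n + 1) (κ₁, s₁) (ν, w))
        = ∑ w ∈ S, c w * compLinKer (fun _ => symLinKerAt (toSite R.r) Lc) Lc (n + 1) (κ₁, s₁) (ν, w) :=
    fun c ν => tsum_eq_sum fun w hw => by rw [hzero ν w hw, mul_zero]
  -- step 3: exchange `Σ'_m` with the finite sums
  obtain ⟨δ, C, hδ, hC, hA⟩ := decays_KInv (N := Lc ^ (n + 1 + 1)) (d := 3)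
  have hsum : ∀ (ν : Fin (3 + 1)) (w : Site (3 + 1)), Summable fun m : Site (3 + 1) =>
      lamCoeffOf (KInv (N := Lc ^ (n + 1 + 1)) (d := 3)) (Lc ^ (n + 1 + 1)) ν w κ' (translate (towerTorus Lc (fine Lc M) (n + 1)) x m) :=
    fun ν w => summable_lamCoeffOf_translate (towerTorus Lc (fine Lc M) (n + 1)) hA hC hδ (Lc ^ (n + 1 + 1)) ν w κ' x
  have hL2 : ∀ m : Site (3 + 1), (∑ ν : Fin (3 + 1), ∑' w : Site (3 + 1),
        lamCoeffOf (KInv (N := Lc ^ (n + 1 + 1)) (d := 3)) (Lc ^ (n + 1 + 1)) ν w κ' (translate (towerTorus Lc (fine Lc M) (n + 1)) x m)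
          * compLinKer (fun _ => symLinKerAt (toSite R.r) Lc) Lc (n + 1) (κ₁, s₁) (ν, w))
      = ∑ ν : Fin (3 + 1), ∑ w ∈ S,
          lamCoeffOf (KInv (N := Lc ^ (n + 1 + 1)) (d := 3)) (Lc ^ (n + 1 + 1)) ν w κ' (translate (towerTorus Lc (fine Lc M) (n + 1)) x m)
            * compLinKer (fun _ => symLinKerAt (toSite R.r) Lc) Lc (n + 1) (κ₁, s₁) (ν, w) :=
    fun m => Finset.sum_congr rfl fun ν _ => hfin (fun w => lamCoeffOf (KInv (N := Lc ^ (n + 1 + 1)) (d := 3)) (Lc ^ (n + 1 + 1)) ν w κ'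
      (translate (towerTorus Lc (fine Lc M) (n + 1)) x m)) ν
  have hR2 : ∀ ν : Fin (3 + 1), (∑' w : Site (3 + 1),
        (∑' m : Site (3 + 1), lamCoeffOf (KInv (N := Lc ^ (n + 1 + 1)) (d := 3)) (Lc ^ (n + 1 + 1)) ν w κ'
            (translate (towerTorus Lc (fine Lc M) (n + 1)) x m))
          * compLinKer (fun _ => symLinKerAt (toSite R.r) Lc) Lc (n + 1) (κ₁, s₁) (ν, w))
      = ∑ w ∈ S, (∑' m : Site (3 + 1), lamCoeffOf (KInv (N := Lc ^ (n + 1 + 1)) (d := 3)) (Lc ^ (n + 1 + 1)) ν w κ'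
            (translate (towerTorus Lc (fine Lc M) (n + 1)) x m))
          * compLinKer (fun _ => symLinKerAt (toSite R.r) Lc) Lc (n + 1) (κ₁, s₁) (ν, w) :=
    fun ν => hfin (fun w => ∑' m : Site (3 + 1), lamCoeffOf (KInv (N := Lc ^ (n + 1 + 1)) (d := 3)) (Lc ^ (n + 1 + 1)) ν w κ'
      (translate (towerTorus Lc (fine Lc M) (n + 1)) x m)) ν
  rw [tsum_congr hL2, Finset.sum_congr rfl fun ν _ => hR2 ν,
    Summable.tsum_finsetSum (fun ν _ => summable_sum fun w _ => (hsum ν w).mul_right _)]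
  refine Finset.sum_congr rfl fun ν _ => ?_
  rw [Summable.tsum_finsetSum (fun w _ => (hsum ν w).mul_right _)]
  exact Finset.sum_congr rfl fun w _ => tsum_mul_right

/-- [folklore] **`summable_cfTop_translate` — the wrapper's `hcf` row at the finest level**: `m ↦ cfTop κ₁ (translate T′ s₁ m) κ′ x` is summable (§1's covariance
makes each term a FINITE sum of translates of the straight fold, each summable by O-2 `summable_lamCoeffOf_translate`, composed with `m ↦ −m`). -/
theorem summable_cfTop_translate (κ₁ : Fin (3 + 1)) (s₁ : Site (3 + 1)) (κ' : Fin (3 + 1)) (x : Site (3 + 1)) :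
    Summable fun m : Site (3 + 1) => ∑ ν : Fin (3 + 1), ∑' w : Site (3 + 1),
        lamCoeffOf (KInv (N := Lc ^ (n + 1 + 1)) (d := 3)) (Lc ^ (n + 1 + 1)) ν w κ' x
          * compLinKer (fun _ => symLinKerAt (toSite R.r) Lc) Lc (n + 1) (κ₁, translate (towerTorus Lc M (n + 1)) s₁ m) (ν, w) := by
  have hL : 0 < Lc := Nat.pos_of_ne_zero (NeZero.ne Lc)
  obtain ⟨δ, C, hδ, hC, hA⟩ := decays_KInv (N := Lc ^ (n + 1 + 1)) (d := 3)
  set S : Finset (Site (3 + 1)) := Fintype.piFinset fun i =>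
    Finset.Icc ((s₁ i - (wid Lc (n + 1) : ℤ)) / ((Lc ^ (n + 1) : ℕ) : ℤ)) (s₁ i / ((Lc ^ (n + 1) : ℕ) : ℤ)) with hS
  have hzero : ∀ (ν : Fin (3 + 1)) (w : Site (3 + 1)), w ∉ S →
      compLinKer (fun _ => symLinKerAt (toSite R.r) Lc) Lc (n + 1) (κ₁, s₁) (ν, w) = 0 := fun ν w hw =>
    compLinKer_eq_zero (n + 1) (f := (κ₁, s₁)) (g := (ν, w)) fun h => hw (mem_piFinset_of_mem_winF (pow_pos hL (n + 1)) h)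
  have heq : ∀ m : Site (3 + 1), (∑ ν : Fin (3 + 1), ∑' w : Site (3 + 1),
        lamCoeffOf (KInv (N := Lc ^ (n + 1 + 1)) (d := 3)) (Lc ^ (n + 1 + 1)) ν w κ' x
          * compLinKer (fun _ => symLinKerAt (toSite R.r) Lc) Lc (n + 1) (κ₁, translate (towerTorus Lc M (n + 1)) s₁ m) (ν, w))
      = ∑ ν : Fin (3 + 1), ∑ w ∈ S,
          lamCoeffOf (KInv (N := Lc ^ (n + 1 + 1)) (d := 3)) (Lc ^ (n + 1 + 1)) ν w κ' (translate (towerTorus Lc (fine Lc M) (n + 1)) x (-m))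
            * compLinKer (fun _ => symLinKerAt (toSite R.r) Lc) Lc (n + 1) (κ₁, s₁) (ν, w) := fun m => by
    rw [cfTop_translate R n M κ₁ s₁ κ' x m]
    exact Finset.sum_congr rfl fun ν _ => tsum_eq_sum fun w hw => by rw [hzero ν w hw, mul_zero]
  refine (summable_congr heq).2 (summable_sum fun ν _ => summable_sum fun w _ => Summable.mul_right _ ?_)
  exact (summable_lamCoeffOf_translate (towerTorus Lc (fine Lc M) (n + 1)) hA hC hδ (Lc ^ (n + 1 + 1)) ν w κ' x).comp_injective
    neg_injective

end Coefficients

/-! ## §2 (β): the exact part of the direction is dead on both sides -/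

section Exact

/-- [folklore] **(β)-LEFT — THE PERIODISED FIELD BLOCK KILLS EVERY TORUS PURE GAUGE**: for every box `T`, root `rH ∈ box 4 Lc`, gauge function `λ` and bond `u`,
`Σ_b (perF T (bhKStepAt 3 (toSite rH) Lc 0))|ff (u, b)·(Σ_t tgrad T b♭ t·λ t) = 0` (road `PeriodisedWardOrderZero.sum_perZ_bhKStepAt_ff_mul_tgrad`, summed against `λ`;
no `towerGen ∕ θ` needed — #21's `torus_a0_tower` is the special case `λ := towerEvalC·θ`). -/
theorem ff_mul_exact_sum_eq_zero {rH : Fin (3 + 1) → ℕ} (hrH : rH ∈ box (3 + 1) Lc) (T : Fin (3 + 1) → ℕ) [∀ i, NeZero (T i)]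
    (lam : ↥(pbox T) → ℝ) (u : ↥(pbox T) × Fin (3 + 1)) :
    ∑ b : ↥(pbox T) × Fin (3 + 1), perF T (bhKStepAt 3 (toSite rH) Lc 0) (u.1, Sum.inl u.2) (b.1, Sum.inl b.2)
        * (∑ t : ↥(pbox T), tgrad T (b.1, Sum.inl b.2) t * lam t) = 0 := by
  calc ∑ b : ↥(pbox T) × Fin (3 + 1), perF T (bhKStepAt 3 (toSite rH) Lc 0) (u.1, Sum.inl u.2) (b.1, Sum.inl b.2)
          * (∑ t : ↥(pbox T), tgrad T (b.1, Sum.inl b.2) t * lam t)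
      = ∑ t : ↥(pbox T), lam t * ∑ b : ↥(pbox T) × Fin (3 + 1),
          perF T (bhKStepAt 3 (toSite rH) Lc 0) (u.1, Sum.inl u.2) (b.1, Sum.inl b.2) * tgrad T (b.1, Sum.inl b.2) t := by
        simp only [Finset.mul_sum]
        rw [Finset.sum_comm]
        exact Finset.sum_congr rfl fun t _ => Finset.sum_congr rfl fun b _ => by ring
    _ = 0 := Finset.sum_eq_zero fun t _ => by
        rw [Fintype.sum_prod_type]
        simp only [perF_apply]
        rw [sum_perZ_bhKStepAt_ff_mul_tgrad T hrH 0 (u.1 : Site (3 + 1)) u.2 t, mul_zero]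

/-- [folklore] **(β)-RIGHT — THE SLOT-PERIODISED TRANSPORTED FOLD KILLS EVERY TORUS PURE GAUGE**: for every lower slot `(κ₁, s₁)` and gauge function `λ` on the bond torus
`T = towerTorus Lc (fine Lc M) (n+1)`,  `Σ_ā (Σ_t tgrad T ā♭ t·λ t)·(Σ'_m cfTop κ₁ (translate T′ s₁ m) ā.2 ā.1) = 0` — §1 (F1) puts the leg in front of leaf-03 O-2's
site-periodised straight folds `Λ̂_{ν,w}`, each of which is killed by `sum_tgrad_mul_periodisedLamFold_eq_zero` (A := `KInv L`, box := `T`). -/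
theorem sum_exact_mul_tsum_cfTop_eq_zero (κ₁ : Fin (3 + 1)) (s₁ : Site (3 + 1)) (lam : ↥(pbox (towerTorus Lc (fine Lc M) (n + 1))) → ℝ) :
    ∑ ā : ↥(pbox (towerTorus Lc (fine Lc M) (n + 1))) × Fin (3 + 1),
        (∑ t : ↥(pbox (towerTorus Lc (fine Lc M) (n + 1))), tgrad (towerTorus Lc (fine Lc M) (n + 1)) (ā.1, Sum.inl ā.2) t * lam t)
          * (∑' m : Site (3 + 1), ∑ ν : Fin (3 + 1), ∑' w : Site (3 + 1),
              lamCoeffOf (KInv (N := Lc ^ (n + 1 + 1)) (d := 3)) (Lc ^ (n + 1 + 1)) ν w ā.2 (ā.1 : Site (3 + 1))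
                * compLinKer (fun _ => symLinKerAt (toSite R.r) Lc) Lc (n + 1) (κ₁, translate (towerTorus Lc M (n + 1)) s₁ m) (ν, w)) = 0 := by
  have hL : 0 < Lc := Nat.pos_of_ne_zero (NeZero.ne Lc)
  obtain ⟨δ, C, hδ, hC, hA⟩ := decays_KInv (N := Lc ^ (n + 1 + 1)) (d := 3)
  simp_rw [tsum_cfTop_translate_eq R n M κ₁ s₁]
  calc ∑ ā : ↥(pbox (towerTorus Lc (fine Lc M) (n + 1))) × Fin (3 + 1),
        (∑ t : ↥(pbox (towerTorus Lc (fine Lc M) (n + 1))), tgrad (towerTorus Lc (fine Lc M) (n + 1)) (ā.1, Sum.inl ā.2) t * lam t)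
          * ∑ ν : Fin (3 + 1), ∑' w : Site (3 + 1),
              (∑' m : Site (3 + 1), lamCoeffOf (KInv (N := Lc ^ (n + 1 + 1)) (d := 3)) (Lc ^ (n + 1 + 1)) ν w ā.2
                  (translate (towerTorus Lc (fine Lc M) (n + 1)) (ā.1 : Site (3 + 1)) m))
                * compLinKer (fun _ => symLinKerAt (toSite R.r) Lc) Lc (n + 1) (κ₁, s₁) (ν, w)
      = ∑ ν : Fin (3 + 1), ∑ ā : ↥(pbox (towerTorus Lc (fine Lc M) (n + 1))) × Fin (3 + 1), ∑' w : Site (3 + 1),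
          (∑ t : ↥(pbox (towerTorus Lc (fine Lc M) (n + 1))), tgrad (towerTorus Lc (fine Lc M) (n + 1)) (ā.1, Sum.inl ā.2) t * lam t)
            * ((∑' m : Site (3 + 1), lamCoeffOf (KInv (N := Lc ^ (n + 1 + 1)) (d := 3)) (Lc ^ (n + 1 + 1)) ν w ā.2
                  (translate (towerTorus Lc (fine Lc M) (n + 1)) (ā.1 : Site (3 + 1)) m))
                * compLinKer (fun _ => symLinKerAt (toSite R.r) Lc) Lc (n + 1) (κ₁, s₁) (ν, w)) := by
        rw [Finset.sum_comm]
        refine Finset.sum_congr rfl fun ā _ => ?_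
        rw [Finset.mul_sum]
        exact Finset.sum_congr rfl fun ν _ => tsum_mul_left.symm
    _ = ∑ ν : Fin (3 + 1), ∑' w : Site (3 + 1), ∑ ā : ↥(pbox (towerTorus Lc (fine Lc M) (n + 1))) × Fin (3 + 1),
          (∑ t : ↥(pbox (towerTorus Lc (fine Lc M) (n + 1))), tgrad (towerTorus Lc (fine Lc M) (n + 1)) (ā.1, Sum.inl ā.2) t * lam t)
            * ((∑' m : Site (3 + 1), lamCoeffOf (KInv (N := Lc ^ (n + 1 + 1)) (d := 3)) (Lc ^ (n + 1 + 1)) ν w ā.2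
                  (translate (towerTorus Lc (fine Lc M) (n + 1)) (ā.1 : Site (3 + 1)) m))
                * compLinKer (fun _ => symLinKerAt (toSite R.r) Lc) Lc (n + 1) (κ₁, s₁) (ν, w)) :=
        Finset.sum_congr rfl fun ν _ => (Summable.tsum_finsetSum fun ā _ =>
          (summable_mul_compLinKer hL (n + 1) ((κ₁, s₁) : Bond (3 + 1)) ν (fun w =>
            (∑ t : ↥(pbox (towerTorus Lc (fine Lc M) (n + 1))), tgrad (towerTorus Lc (fine Lc M) (n + 1)) (ā.1, Sum.inl ā.2) t * lam t)
              * ∑' m : Site (3 + 1), lamCoeffOf (KInv (N := Lc ^ (n + 1 + 1)) (d := 3)) (Lc ^ (n + 1 + 1)) ν w ā.2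
                  (translate (towerTorus Lc (fine Lc M) (n + 1)) (ā.1 : Site (3 + 1)) m))).congr fun w => mul_assoc _ _ _).symm
    _ = ∑ ν : Fin (3 + 1), ∑' w : Site (3 + 1),
          (∑ ā : ↥(pbox (towerTorus Lc (fine Lc M) (n + 1))) × Fin (3 + 1),
            (∑ t : ↥(pbox (towerTorus Lc (fine Lc M) (n + 1))), tgrad (towerTorus Lc (fine Lc M) (n + 1)) (ā.1, Sum.inl ā.2) t * lam t)
              * (∑' m : Site (3 + 1), lamCoeffOf (KInv (N := Lc ^ (n + 1 + 1)) (d := 3)) (Lc ^ (n + 1 + 1)) ν w ā.2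
                  (translate (towerTorus Lc (fine Lc M) (n + 1)) (ā.1 : Site (3 + 1)) m)))
            * compLinKer (fun _ => symLinKerAt (toSite R.r) Lc) Lc (n + 1) (κ₁, s₁) (ν, w) :=
        Finset.sum_congr rfl fun ν _ => tsum_congr fun w => by
          rw [Finset.sum_mul]
          exact Finset.sum_congr rfl fun ā _ => (mul_assoc _ _ _).symm
    _ = 0 := Finset.sum_eq_zero fun ν _ => (tsum_congr fun w => by
          rw [sum_tgrad_mul_periodisedLamFold_eq_zero (towerTorus Lc (fine Lc M) (n + 1)) hA hC hδ (Lc ^ (n + 1 + 1)) ν w lam,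
            zero_mul]).trans tsum_zero

end Exact

/-! ## §3 Bookkeeping: the finite bond sum moves inside the slot sum; a linear functional is read off the basis slots -/

section Bookkeeping

/-- [folklore] the finite bond sum `Σ_ā` moves inside `Σ_{κ₁} Σ'_{s₁}`: the brick row `s₁ ↦ symLinKerAt (toSite R.r) Lc κ₁ s₁ (u.2, u.1)` is finitely supported
(`symLinKerAt_eq_zero` off the support box of `u.1`; an2 g60 `summable_of_near`), so every `s₁`-family here is summable. -/
theorem sum_mul_sum_tsum_mul_symLinKerAt_comm (T : Fin (3 + 1) → ℕ) [∀ i, NeZero (T i)] (f : ↥(pbox T) × Fin (3 + 1) → ℝ)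
    (g : Fin (3 + 1) → Site (3 + 1) → ↥(pbox T) × Fin (3 + 1) → ℝ) (u : ↥(pbox T) × Fin (3 + 1)) :
    ∑ ā : ↥(pbox T) × Fin (3 + 1), f ā * ∑ κ₁ : Fin (3 + 1), ∑' s₁ : Site (3 + 1),
        g κ₁ s₁ ā * symLinKerAt (toSite R.r) Lc κ₁ s₁ (u.2, (u.1 : Site (3 + 1)))
      = ∑ κ₁ : Fin (3 + 1), ∑' s₁ : Site (3 + 1), (∑ ā : ↥(pbox T) × Fin (3 + 1), f ā * g κ₁ s₁ ā)
          * symLinKerAt (toSite R.r) Lc κ₁ s₁ (u.2, (u.1 : Site (3 + 1))) := by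
  have hL : 0 < Lc := Nat.pos_of_ne_zero (NeZero.ne Lc)
  have hs : ∀ (κ₁ : Fin (3 + 1)) (c : Site (3 + 1) → ℝ),
      Summable fun s₁ : Site (3 + 1) => c s₁ * symLinKerAt (toSite R.r) Lc κ₁ s₁ (u.2, (u.1 : Site (3 + 1))) :=
    fun κ₁ c => summable_of_near hL (u.1 : Site (3 + 1)) fun s₁ hs₁ => by rw [symLinKerAt_eq_zero R.hr hs₁, mul_zero]
  calc ∑ ā : ↥(pbox T) × Fin (3 + 1), f ā * ∑ κ₁ : Fin (3 + 1), ∑' s₁ : Site (3 + 1),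
        g κ₁ s₁ ā * symLinKerAt (toSite R.r) Lc κ₁ s₁ (u.2, (u.1 : Site (3 + 1)))
      = ∑ ā : ↥(pbox T) × Fin (3 + 1), ∑ κ₁ : Fin (3 + 1), ∑' s₁ : Site (3 + 1),
          f ā * (g κ₁ s₁ ā * symLinKerAt (toSite R.r) Lc κ₁ s₁ (u.2, (u.1 : Site (3 + 1)))) := by
        refine Finset.sum_congr rfl fun ā _ => ?_
        rw [Finset.mul_sum]
        exact Finset.sum_congr rfl fun κ₁ _ => tsum_mul_left.symm
    _ = ∑ κ₁ : Fin (3 + 1), ∑ ā : ↥(pbox T) × Fin (3 + 1), ∑' s₁ : Site (3 + 1),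
          f ā * (g κ₁ s₁ ā * symLinKerAt (toSite R.r) Lc κ₁ s₁ (u.2, (u.1 : Site (3 + 1)))) := Finset.sum_comm
    _ = ∑ κ₁ : Fin (3 + 1), ∑' s₁ : Site (3 + 1), ∑ ā : ↥(pbox T) × Fin (3 + 1),
          f ā * (g κ₁ s₁ ā * symLinKerAt (toSite R.r) Lc κ₁ s₁ (u.2, (u.1 : Site (3 + 1)))) :=
        Finset.sum_congr rfl fun κ₁ _ =>
          (Summable.tsum_finsetSum fun ā _ => ((hs κ₁ (fun s₁ => f ā * g κ₁ s₁ ā)).congr fun s₁ => mul_assoc _ _ _)).symm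
    _ = ∑ κ₁ : Fin (3 + 1), ∑' s₁ : Site (3 + 1), (∑ ā : ↥(pbox T) × Fin (3 + 1), f ā * g κ₁ s₁ ā)
          * symLinKerAt (toSite R.r) Lc κ₁ s₁ (u.2, (u.1 : Site (3 + 1))) :=
        Finset.sum_congr rfl fun κ₁ _ => tsum_congr fun s₁ => by
          rw [Finset.sum_mul]
          exact Finset.sum_congr rfl fun ā _ => (mul_assoc _ _ _).symm

omit [NeZero Lc] in
/-- [folklore] a functional `φ` of the source vector with `φ (r•x + y) = r·φ x + φ y` is read off the basis slots: `φ v = Σ_a v a·φ (e_a)`. -/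
theorem apply_eq_sum_mul_single_of_linear {κ : Type*} [Fintype κ] [DecidableEq κ] (φ : (κ → ℝ) → ℝ)
    (hφ : ∀ (r : ℝ) (x y : κ → ℝ), φ (r • x + y) = r * φ x + φ y) (v : κ → ℝ) :
    φ v = ∑ a : κ, v a * φ (Pi.single a 1) := by
  have h0 : φ 0 = 0 := by
    have h := hφ 1 0 0
    rw [one_smul, add_zero, one_mul] at h
    linarith
  have key : ∀ s : Finset κ, φ (∑ a ∈ s, v a • (Pi.single a (1 : ℝ) : κ → ℝ)) = ∑ a ∈ s, v a * φ (Pi.single a 1) := by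
    intro s
    induction s using Finset.induction_on with
    | empty => rw [Finset.sum_empty, Finset.sum_empty, h0]
    | insert a s ha ih => rw [Finset.sum_insert ha, Finset.sum_insert ha, hφ, ih]
  have hv : v = ∑ a : κ, v a • (Pi.single a (1 : ℝ) : κ → ℝ) := by
    funext b
    simp only [Finset.sum_apply, Pi.smul_apply, Pi.single_apply, smul_eq_mul, mul_ite, mul_one, mul_zero,
      Finset.sum_ite_eq, Finset.mem_univ, if_true]
  conv_lhs => rw [hv]
  exact key Finset.univ

end Bookkeeping

end Summit.QuantumFields.BalabanUV.Beta.FP.TowerK1RowTopCoefficients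

end
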